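import Literature.NumberTheory.Transcendental.GammaIsoCrossSaturationCore
import Literature.NumberTheory.Transcendental.GammaIsoCrossAlgebraicStep
import Literature.NumberTheory.Transcendental.ZilberFieldHomogeneityProofs
import HarnessLib

/-!
# Cross-field `ℵ₀`-saturation for Γ-algebraic extensions over `ℚτ` (Bays–Kirby 2018, Lemma 8.3, two fields)

M. Bays, J. Kirby, *Pseudo-exponential maps, variants, and quasiminimality*, Algebra & Number
Theory 12 (2018), Lemma 8.3 (⟹) with Def. 5.14 and Thm 9.1: an algebraically closed
exponential field with `exp` onto its units, standard kernel and strong exponential-algebraic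
closedness is `ℵ₀`-saturated for finitely generated Γ-algebraic strong extensions of finitely
generated strong Γ-subfields containing `SK = ℚ^{ab}(τ)` — for ABSTRACT extensions, i.e.
extensions presented inside ANY other exponential field with kernel `τ₁ℤ`. The one-field
version is the tree's `BaysKirby2018_saturation_of_isStronglyExpAlgClosed_holds`
(`ZilberFieldHomogeneityProofs.lean`, `ZilberFieldSaturationHolds.lean`); this file is the
**cross-field version** over an isomorphism `σ₀ : ℚ^{ab}(τ₁) ≅ ℚ^{ab}(τ₂)` of the base Γ-fields
(`GammaField.IsEBaseIso₂`, `GammaField.IsGammaIsoTw₂`, `GammaIsoCross.lean`), assembled from the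
cross free case (`ZilberSaturationMain.exists_isGammaIsoTw₂_append_of_free`,
`GammaIsoCrossSaturationCore.lean`) and the cross algebraic step
(`GammaField.IsGammaIsoTw₂.exists_append_single_of_mem_acl`, `GammaIsoCrossAlgebraicStep.lean`),
following the one-field proofs of `ZilberFieldHomogeneityProofs.lean` verbatim with the two
fields kept apart:

* the **logarithmic step** across two fields: transport of the relation ideal of `(a₀, y)` along
  `θ : E ≅ E'` (`aeval_sumElim_eq_zero_iff_map₂`, `isGenericPt_idealMapCoeff₂`), the logarithmic
  partner (`exists_log_partner₂`), `exists_append_single_of_exp_mem_acl₂` (Lemma 8.3, proof: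
  "`A^full ∧ B` embeds over `A`", logarithmic case; §4.4);
* bookkeeping for cross Γ-isomorphisms (`IsGammaIsoTw₂.transport_sum_smul_of_mem`,
  `sup_span_transport_le`, `sup_span_transport_comp_eq`, `transport_eq_transport`,
  `linIndepOver_transport`, `corestep_of_case1₂`);
* the induction on `ldim(B/A)`: `exists_case1_reduct₂` (Case 1: an element of `B ∖ A` algebraic
  or with algebraic exponential over `Γ(A)`), `corestep₂` (Case 2 = the free case);
* `isGammaIsoTw₂_saturation_tau` / `isGammaIsoTw₂_saturation_tau'` — **cross-field Lemma 8.3 over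
  `ℚτ`**: `F₁` with `ker exp = τ₁ℤ`, `F₂` algebraically closed with `exp` onto `F₂ˣ` and strongly
  exponentially-algebraically closed; if `ℚτ₁ + ℚc ◁ F₁`, `ℚτ₂ + ℚc' ◁ F₂`, `c ↦ c'` is a cross
  Γ-isomorphism over `σ₀` and `δ(e/ℚτ₁ + ℚc) = 0`, then there is `e'` in `F₂` with
  `(c, e) ↦ (c', e')` a cross Γ-isomorphism over `σ₀`, `ℚτ₂ + ℚc' + ℚe' ◁ F₂` and
  `δ(e'/ℚτ₂ + ℚc') = 0` (granted the Kummer fact, resp. unconditionally through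
  `Literature.FieldTheory.Kummer.BaysKirby2018_divisionSequences_determined_holds`).

This is the engine of the cross-field back-and-forth proving that the prime models `ecl(∅)` of
two Zilber fields are isomorphic (`ZilberPrimeModelIso.lean`, hypothesis `h₂` of
`ZilberClass.isQuasiminimalPregeometryClass_of`) in Zilber's categoricity theorem. Everything is
proved; no named fact is introduced.

## References

* M. Bays, J. Kirby, *Pseudo-exponential maps, variants, and quasiminimality*, Algebra & Number
  Theory 12 (2018) 493–549: Prop. 3.22, Lemma 4.8, §4.4 (Thm 4.17), Def. 5.14, Lemma 8.3, Thm 9.1.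
* B. Zilber, *Pseudo-exponentiation on algebraically closed fields of characteristic zero*,
  Ann. Pure Appl. Logic 132 (2005): Thm 1.1, §5.
-/

noncomputable section

open Set MvPolynomial

universe u

namespace Literature.NumberTheory.Transcendental

namespace ZilberSaturationLog

open GammaField Literature.ModelTheory.ExponentialFields.ExponentialRing ZilberHomogeneity
  ZilberSaturationMain

/-! ### Transport of relation ideals along an isomorphism of coefficient fields, two fields -/

section GenTransport₂

variable {F₁ F₂ : Type*} [Field F₁] [Field F₂] {E E' : Type*} [Field E] [Field E']
  [Algebra E F₁] [Algebra E' F₂] (θ : E ≃+* E')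

/-- **Univariate transport of vanishing, across two fields.** If `y ∈ F₁` is integral over `E` and
`w ∈ F₂` is a root of the image under `θ : E ≅ E'` of its minimal polynomial, then a polynomial
over `E` vanishes at `y` iff its `θ`-image vanishes at `w`. [folklore] -/
theorem aeval_eq_zero_iff_aeval_map_eq_zero₂ {y : F₁} {w : F₂} (hyi : IsIntegral E y)
    (hw : Polynomial.eval₂ ((algebraMap E' F₂).comp (θ : E →+* E')) w (minpoly E y) = 0)
    (s : Polynomial E) :
    Polynomial.aeval y s = 0 ↔ Polynomial.aeval w (s.map (θ : E →+* E')) = 0 := by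
  have hqirr : Irreducible (minpoly E y) := minpoly.irreducible hyi
  have hqm : (minpoly E y).Monic := minpoly.monic hyi
  have hmap : ∀ p : Polynomial E, p.map (θ : E →+* E') = Polynomial.mapEquiv θ p := fun p =>
    (Polynomial.mapEquiv_apply θ p).symm
  have hγ : minpoly E' w = (minpoly E y).map (θ : E →+* E') := by
    symm
    refine minpoly.eq_of_irreducible_of_monic ?_ ?_ (hqm.map _)
    · rw [hmap]
      exact (MulEquiv.irreducible_iff (Polynomial.mapEquiv θ)).2 hqirr
    · rw [Polynomial.aeval_def, Polynomial.eval₂_map]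
      exact hw
  rw [← minpoly.dvd_iff, ← minpoly.dvd_iff, hγ, hmap, hmap, map_dvd_iff]

/-- Transport of vanishing for polynomials in one `MvPolynomial` variable, across two fields.
[folklore] -/
theorem aeval_single_eq_zero_iff_map₂ {y : F₁} {w : F₂} (hyi : IsIntegral E y)
    (hw : Polynomial.eval₂ ((algebraMap E' F₂).comp (θ : E →+* E')) w (minpoly E y) = 0)
    (r : MvPolynomial (Fin 1) E) :
    aeval ![y] r = 0 ↔ aeval ![w] (MvPolynomial.map (θ : E →+* E') r) = 0 := by
  rw [aeval_single_eq, aeval_single_eq, ← map_aeval_X_eq]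
  exact aeval_eq_zero_iff_aeval_map_eq_zero₂ θ hyi hw _

/-- **Transport of the relation ideal of `(a₀, y)` across two fields.** Let `θ : E ≅ E'` with
`E → F₁`, `E' → F₂`, `y ∈ F₁` integral over `E`, `w ∈ F₂` a root of `θ(minpoly y)`, `a₀ ∈ F₁`
transcendental over `E[y]` and `x₀ ∈ F₂` transcendental over `E'[w]`. Then a polynomial over `E`
vanishes at `(a₀, y)` iff its `θ`-image vanishes at `(x₀, w)`.
[cite: BaysKirby2018ANT, §4.4 (Thm 4.17, proof)] -/
theorem aeval_sumElim_eq_zero_iff_map₂ {y a₀ : F₁} {w x₀ : F₂} (hyi : IsIntegral E y)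
    (hw : Polynomial.eval₂ ((algebraMap E' F₂).comp (θ : E →+* E')) w (minpoly E y) = 0)
    (ha : AlgebraicIndependent (Algebra.adjoin E (range ![y])) ![a₀])
    (hx : AlgebraicIndependent (Algebra.adjoin E' (range ![w])) ![x₀])
    (g : MvPolynomial (Fin 1 ⊕ Fin 1) E) :
    aeval (Sum.elim ![a₀] ![y]) g = 0 ↔
      aeval (Sum.elim ![x₀] ![w]) (MvPolynomial.map (θ : E →+* E') g) = 0 := by
  rw [aeval_sumElim_eq_zero_iff ha, aeval_sumElim_eq_zero_iff hx, sumAlgEquiv_map]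
  simp only [MvPolynomial.coeff_map]
  exact forall_congr' fun m => aeval_single_eq_zero_iff_map₂ θ hyi hw _

/-- **Generic points transport along `θ`, across two fields**: `(x₀, w)` is a generic point of the
`θ`-image of the relation ideal of `(a₀, y)` over `E`. [cite: BaysKirby2018ANT, §4.4 (Thm 4.17, proof)] -/
theorem isGenericPt_idealMapCoeff₂ {F₁ F₂ : Type u} [Field F₁] [Field F₂] {E E' : Type u} [Field E]
    [Field E'] [Algebra E F₁] [Algebra E' F₂] (θ : E ≃+* E') {y a₀ : F₁} {w x₀ : F₂}
    (hyi : IsIntegral E y)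
    (hw : Polynomial.eval₂ ((algebraMap E' F₂).comp (θ : E →+* E')) w (minpoly E y) = 0)
    (ha : AlgebraicIndependent (Algebra.adjoin E (range ![y])) ![a₀])
    (hx : AlgebraicIndependent (Algebra.adjoin E' (range ![w])) ![x₀]) :
    IsGenericPt (LocusComponents.idealMapCoeff θ (locIdeal E (Sum.elim ![a₀] ![y])))
      (Sum.elim ![x₀] ![w]) := by
  intro f
  set g : MvPolynomial (Fin 1 ⊕ Fin 1) E := MvPolynomial.map (θ.symm : E' →+* E) f with hg
  have hfg : f = MvPolynomial.map (θ : E →+* E') g := by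
    rw [hg, MvPolynomial.map_map]
    have : (θ : E →+* E').comp (θ.symm : E' →+* E) = RingHom.id E' := by
      ext e; simp
    rw [this, MvPolynomial.map_id]
  have h1 : aeval (Sum.elim ![x₀] ![w]) f = 0 ↔ aeval (Sum.elim ![a₀] ![y]) g = 0 := by
    rw [hfg]; exact (aeval_sumElim_eq_zero_iff_map₂ θ hyi hw ha hx g).symm
  rw [h1, isGenericPt_locIdeal E (Sum.elim ![a₀] ![y]) g, LocusComponents.idealMapCoeff,
    ← Ideal.comap_symm, Ideal.mem_comap]
  have h2 : (MvPolynomial.mapEquiv (Fin 1 ⊕ Fin 1) θ).symm f = g := by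
    rw [hg, MvPolynomial.mapEquiv_symm, MvPolynomial.mapEquiv_apply]
  rw [h2]

end GenTransport₂

/-! ### The logarithmic partner in the second field -/

section LogPartner₂

variable {F₁ : Type u} [Field F₁] [CharZero F₁] [Literature.ModelTheory.ExponentialFields.ExponentialRing F₁]
variable {F₂ : Type u} [Field F₂] [CharZero F₂] [Literature.ModelTheory.ExponentialFields.ExponentialRing F₂]
variable {K₁ : Submodule ℚ F₁} {K₂ : Submodule ℚ F₂} {σ : fieldOf K₁ ≃+* fieldOf K₂} {N : ℕ}
  {c : Fin N → F₁} {c' : Fin N → F₂}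

/-- **The logarithmic partner, in the second field.** Let `c ↦ c'` be a cross Γ-isomorphism
over an isomorphism `σ` of base Γ-fields, between strong subspaces `X = K₁ + ℚc ≤ F₁`,
`X' = K₂ + ℚc' ≤ F₂`, with `F₂` algebraically closed with `exp` onto `F₂ˣ` and `ker exp ⊆ X` in
`F₁`. If `a₀ ∉ X` has `exp a₀` algebraic over `⟨K₁ c⟩`, then there is `x₀ ∉ X'` in `F₂` with
`exp x₀` algebraic over `⟨K₂ c'⟩` such that `(x₀, exp x₀)` is a generic point of the transport
`θ(loc((a₀, exp a₀)/⟨K₁ c⟩))` over `⟨K₂ c'⟩`.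
[cite: BaysKirby2018ANT, §4.4 (Thm 4.17, proof), Lemma 8.3 (proof)] -/
theorem exists_log_partner₂ [IsAlgClosed F₂] (hsurj : IsSurjectiveOntoUnits F₂)
    (hiso : IsGammaIsoTw₂ σ c c') (hσ : IsEBaseIso₂ K₁ K₂ σ)
    (hX : IsStrong (K₁ ⊔ Submodule.span ℚ (range c)))
    (hX' : IsStrong (K₂ ⊔ Submodule.span ℚ (range c')))
    (hker : ∀ z : F₁, exp z = 1 → z ∈ K₁ ⊔ Submodule.span ℚ (range c))
    {a₀ : F₁} (hya : exp a₀ ∈ acl (gens (K₁ ⊔ Submodule.span ℚ (range c))))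
    (ha₀ : a₀ ∉ K₁ ⊔ Submodule.span ℚ (range c)) :
    ∃ x₀ : F₂, IsGenericPt (locusIdeal₂' K₁ K₂ hiso ![a₀]) (gammaPt ![x₀]) ∧
      x₀ ∉ K₂ ⊔ Submodule.span ℚ (range c') ∧
      exp x₀ ∈ acl (gens (K₂ ⊔ Submodule.span ℚ (range c'))) := by
  classical
  set X := K₁ ⊔ Submodule.span ℚ (range c) with hXdef
  set X' := K₂ ⊔ Submodule.span ℚ (range c') with hX'def
  set E : IntermediateField (fieldOf K₁) F₁ := bfld K₁ c with hE
  set E' : IntermediateField (fieldOf K₂) F₂ := bfld K₂ c' with hE'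
  set θ : E ≃+* E' := hiso.fieldEquiv with hθ
  set y : F₁ := exp a₀ with hy
  have hyi : IsIntegral E y := isIntegral_adjoinField_of_mem_acl hya
  set q : Polynomial E := minpoly E y with hq
  set q' : Polynomial E' := q.map (θ : E →+* E') with hq'
  have hqirr : Irreducible q := minpoly.irreducible hyi
  have hmapq : q' = Polynomial.mapEquiv θ q := (Polynomial.mapEquiv_apply θ q).symm
  have hq'irr : Irreducible q' := by
    rw [hmapq]; exact (MulEquiv.irreducible_iff (Polynomial.mapEquiv θ)).2 hqirr
  -- a root `w` of `θ(q)` in `F₂`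
  have hdeg : (q'.map (algebraMap E' F₂)).degree ≠ 0 := by
    rw [Polynomial.degree_map]
    exact (Polynomial.degree_pos_of_irreducible hq'irr).ne'
  obtain ⟨w, hwroot⟩ := IsAlgClosed.exists_root _ hdeg
  have hw : Polynomial.eval₂ ((algebraMap E' F₂).comp (θ : E →+* E')) w q = 0 := by
    rw [← Polynomial.eval₂_map, ← hq', ← Polynomial.eval_map]
    exact hwroot
  have hwq' : Polynomial.aeval w q' = 0 := by
    rw [Polynomial.aeval_def, hq', Polynomial.eval₂_map]; exact hw
  -- `w ≠ 0`
  have hw0 : w ≠ 0 := by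
    intro hw0
    have h0 : q.coeff 0 ≠ 0 := minpoly.coeff_zero_ne_zero hyi (exp_ne_zero a₀)
    have h1 : (q'.map (algebraMap E' F₂)).coeff 0 = 0 := by
      rw [Polynomial.coeff_zero_eq_eval_zero]
      rw [hw0] at hwroot
      exact hwroot
    rw [Polynomial.coeff_map, map_eq_zero, hq', Polynomial.coeff_map] at h1
    exact h0 ((map_eq_zero_iff _ θ.injective).1 h1)
  obtain ⟨x₀, hx₀⟩ := hsurj w hw0
  -- `w` is algebraic over `⟨K₂ c'⟩`
  have hwalg : IsAlgebraic E' w := ⟨q', hq'irr.ne_zero, hwq'⟩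
  have hwacl : w ∈ acl (gens X') := by
    rw [hX'def, ← acl_coe_adjoinField_eq K₂ c']
    exact mem_acl_coe_of_isAlgebraic E' hwalg
  -- `x₀ ∉ X'`
  have hx₀X' : x₀ ∉ X' := by
    intro hx₀X'
    have hwE' : exp x₀ ∈ E' := exp_mem_adjoinField_of_mem hx₀X'
    set v : F₁ := hiso.symm.transport x₀ with hv
    have hvX : v ∈ X := hiso.symm.transport_mem hσ.symm hx₀X'
    -- `θ⁻¹ (exp x₀) = exp v`
    have hval : ((θ.symm ⟨exp x₀, hwE'⟩ : E) : F₁) = exp v := by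
      rw [hθ, hiso.coe_fieldEquiv_symm_eq, hv]
      exact hiso.symm.coe_fieldEquiv_exp hσ.symm hx₀X' hwE'
    -- `θ⁻¹ (exp x₀)` is a root of `q`
    have hroot' : q'.IsRoot ⟨exp x₀, hwE'⟩ := by
      have h0 : Polynomial.aeval (exp x₀) q' = 0 := by rw [hx₀]; exact hwq'
      have h1 : algebraMap E' F₂ (Polynomial.aeval (⟨exp x₀, hwE'⟩ : E') q') = 0 := by
        rw [← Polynomial.aeval_algebraMap_apply F₂ (⟨exp x₀, hwE'⟩ : E') q']; exact h0
      have h2 : Polynomial.aeval (⟨exp x₀, hwE'⟩ : E') q' = 0 :=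
        (algebraMap E' F₂).injective (by rw [h1, map_zero])
      rwa [Polynomial.coe_aeval_eq_eval] at h2
    have hqq' : q = q'.map (θ.symm : E' →+* E) := by
      rw [hq', Polynomial.map_map]
      have : (θ.symm : E' →+* E).comp (θ : E →+* E') = RingHom.id E := by
        ext e; simp
      rw [this, Polynomial.map_id]
    have hroot : q.IsRoot (θ.symm ⟨exp x₀, hwE'⟩) := by
      rw [Polynomial.IsRoot, hqq', Polynomial.eval_map, ← RingEquiv.coe_toRingHom, Polynomial.eval₂_hom,
        hroot'.eq_zero, map_zero]
    have hdeg1 : q.degree = 1 := Polynomial.degree_eq_one_of_irreducible_of_root hqirr hroot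
    obtain ⟨e₁, he₁⟩ := minpoly.mem_range_of_degree_eq_one E y hdeg1
    have hqe : q = Polynomial.X - Polynomial.C e₁ := by
      rw [hq, ← he₁]; exact minpoly.eq_X_sub_C (B := F₁) e₁
    have hr₀ : θ.symm ⟨exp x₀, hwE'⟩ = e₁ := by
      have := hroot
      rw [hqe, Polynomial.IsRoot, Polynomial.eval_sub, Polynomial.eval_X, Polynomial.eval_C,
        sub_eq_zero] at this
      exact this
    have hexp : exp a₀ = exp v := by
      rw [← hval, hr₀]; exact he₁.symm
    have hker' : a₀ - v ∈ X := by
      refine hker _ ?_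
      rw [sub_eq_add_neg, exp_add, exp_neg_eq_inv, hexp, mul_inv_cancel₀ (exp_ne_zero v)]
    exact ha₀ (by simpa using X.add_mem hker' hvX)
  refine ⟨x₀, ?_, hx₀X', hx₀ ▸ hwacl⟩
  -- genericity
  have ha : AlgebraicIndependent (Algebra.adjoin E (range ![y])) ![a₀] :=
    algebraicIndependent_single_adjoin E (coe_bfld_subset_acl K₁ c)
      (not_mem_acl_of_exp_mem_acl hX hya ha₀)
  have hx : AlgebraicIndependent (Algebra.adjoin E' (range ![w])) ![x₀] := by
    refine algebraicIndependent_single_adjoin E' (coe_bfld_subset_acl K₂ c') ?_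
    rw [← hx₀]
    exact not_mem_acl_of_exp_mem_acl hX' (hx₀ ▸ hwacl) hx₀X'
  have key := isGenericPt_idealMapCoeff₂ θ hyi hw ha hx
  show IsGenericPt (LocusComponents.idealMapCoeff hiso.fieldEquiv
    (locIdeal (bfld K₁ c) (gammaPt ![a₀]))) (gammaPt ![x₀])
  rw [gammaPt_single, gammaPt_single, hx₀]
  exact key

end LogPartner₂

/-! ### The logarithmic step over `ℚτ`, across two fields -/

section LogStep₂

open Literature.FieldTheory.Kummer

variable {F₁ : Type u} [Field F₁] [CharZero F₁] [Literature.ModelTheory.ExponentialFields.ExponentialRing F₁]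
variable {F₂ : Type u} [Field F₂] [CharZero F₂] [Literature.ModelTheory.ExponentialFields.ExponentialRing F₂]

set_option maxHeartbeats 800000 in
set_option synthInstance.maxHeartbeats 200000 in
/-- **The logarithmic step over `ℚτ`, across two fields** (cross-field form of
`ZilberSaturationLog.exists_append_single_of_exp_mem_acl`; Bays–Kirby 2018, proof of Lemma 8.3,
logarithmic case of the reduction, cf. §4.4, proof of Thm 4.17): let `F₁` have `ker exp = τ₁ℤ`
(`τ₁ ≠ 0`), `F₂` be algebraically closed with `exp` onto `F₂ˣ`, `σ₀ : ℚ^{ab}(τ₁) ≅ ℚ^{ab}(τ₂)` an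
isomorphism of base Γ-fields; let `ℚτ₁ + ℚc ◁ F₁`, `ℚτ₂ + ℚc' ◁ F₂`, `c ↦ c'` a cross Γ-isomorphism
over `σ₀`, and `d ∉ X = ℚτ₁ + ℚc` in `F₁` with `exp d` algebraic over `ℚ(Γ(X))`. Granted the Kummer
fact, there is `d' ∉ ℚτ₂ + ℚc'` in `F₂` with `exp d'` algebraic over `ℚ(Γ(ℚτ₂ + ℚc'))` and
`(c, d) ↦ (c', d')` a cross Γ-isomorphism over `σ₀`.
[cite: BaysKirby2018ANT, Lemma 8.3 (proof), Prop. 3.22, §4.4, Def. 5.14] -/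
theorem exists_append_single_of_exp_mem_acl₂ [IsAlgClosed F₂] (hsurj : IsSurjectiveOntoUnits F₂)
    {τ₁ : F₁} (hker : expKernel F₁ = AddSubgroup.zmultiples τ₁) (hτ : τ₁ ≠ 0) {τ₂ : F₂}
    (hKfact : BaysKirby2018_divisionSequences_determined.{u})
    {σ₀ : fieldOf (Submodule.span ℚ ({τ₁} : Set F₁)) ≃+* fieldOf (Submodule.span ℚ ({τ₂} : Set F₂))}
    (hσ₀ : IsEBaseIso₂ (Submodule.span ℚ ({τ₁} : Set F₁)) (Submodule.span ℚ ({τ₂} : Set F₂)) σ₀)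
    {N : ℕ} {c : Fin N → F₁} {c' : Fin N → F₂} {d : F₁}
    (hX : IsStrong (Submodule.span ℚ {τ₁} ⊔ Submodule.span ℚ (range c)))
    (hX' : IsStrong (Submodule.span ℚ {τ₂} ⊔ Submodule.span ℚ (range c')))
    (hiso : IsGammaIsoTw₂ σ₀ c c')
    (hd : exp d ∈ acl (gens (Submodule.span ℚ {τ₁} ⊔ Submodule.span ℚ (range c))))
    (hdX : d ∉ Submodule.span ℚ {τ₁} ⊔ Submodule.span ℚ (range c)) :
    ∃ d' : F₂, exp d' ∈ acl (gens (Submodule.span ℚ {τ₂} ⊔ Submodule.span ℚ (range c'))) ∧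
      d' ∉ Submodule.span ℚ {τ₂} ⊔ Submodule.span ℚ (range c') ∧
      IsGammaIsoTw₂ σ₀ (Fin.append c ![d]) (Fin.append c' ![d']) := by
  classical
  set X := (Submodule.span ℚ ({τ₁} : Set F₁)) ⊔ Submodule.span ℚ (range c) with hXdef
  set X' := (Submodule.span ℚ ({τ₂} : Set F₂)) ⊔ Submodule.span ℚ (range c') with hX'def
  set e : Fin 1 → F₁ := ![d] with hedef
  have hτΛ₀ : τ₁ ∈ (Submodule.span ℚ ({τ₁} : Set F₁)) := Submodule.subset_span rfl
  have hτX : τ₁ ∈ X := Submodule.mem_sup_left hτΛ₀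
  have hkerX : ∀ z : F₁, exp z = 1 → z ∈ X := fun z hz => mem_of_exp_eq_one hker hτX hz
  -- Step 1: a basis `u = c ∘ σ` of `X` modulo `ℚτ₁`
  obtain ⟨r, σ, hu, hspan⟩ := exists_linIndepOver_comp (Submodule.span ℚ ({τ₁} : Set F₁)) c
  set u : Fin r → F₁ := c ∘ σ with hudef
  have hXu : X = (Submodule.span ℚ ({τ₁} : Set F₁)) ⊔ Submodule.span ℚ (range u) := by rw [hXdef, ← hspan]
  -- Step 2: the Kummer fact (in `F₁`)
  set S : Set F₁ := {τ₁} ∪ range c ∪ range e with hSdef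
  have hSfin : S.Finite := ((finite_singleton τ₁).union (finite_range c)).union (finite_range e)
  set b : Fin r → F₁ := fun l => exp (u l) with hbdef
  set cK : Fin 1 → F₁ := fun j => exp (e j) with hcK
  have hb0 : ∀ l, b l ≠ 0 := fun l => exp_ne_zero _
  have hc0 : ∀ j, cK j ≠ 0 := fun j => exp_ne_zero _
  have hue : LinIndepOver (Submodule.span ℚ ({τ₁} : Set F₁)) (Fin.append u e) := hu.append_single (by rwa [← hXu])
  have hind : MulIndepModTorsion (Fin.append b cK) := by
    have : Fin.append b cK = fun i => exp (Fin.append u e i) := by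
      rw [comp_append]; rfl
    rw [this]
    exact mulIndepModTorsion_exp hker hue
  obtain ⟨m, hm, H⟩ := hKfact S hSfin b cK hb0 hc0 hind
  -- Step 3: the rescaled element `a = d / m`
  have hm0 : (m : F₁) ≠ 0 := Nat.cast_ne_zero.2 hm.ne'
  set a : Fin 1 → F₁ := fun j => e j / (m : F₁) with hadef
  have hea : ∀ j, (m : F₁) * a j = e j := fun j => by simp only [hadef]; field_simp
  have hea' : (fun j => (m : F₁) * a j) = e := funext hea
  have ha_single : a = ![d / (m : F₁)] := by
    funext j
    rw [Fin.fin_one_eq_zero j]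
    simp [hadef, hedef]
  have hKum : KummerConclusion a S b := by
    intro ρ hρ Ω₂ _ _ σσ hσσ
    exact H (expTuple a) (fun j => by
      change exp (a j) ^ m = exp (e j)
      rw [← exp_nsmul, nsmul_eq_mul, hea]) ρ hρ Ω₂ σσ hσσ
  -- Step 4: the logarithmic partner on the `c'` side, in `F₂`
  have hya : exp (d / (m : F₁)) ∈ acl (gens X) := by
    refine mem_acl_of_pow_mem hm.ne' ?_
    rwa [← exp_nsmul, nsmul_eq_mul, mul_div_cancel₀ _ hm0]
  have ha₀ : d / (m : F₁) ∉ X := by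
    intro h
    apply hdX
    have := X.smul_of_tower_mem m h
    rwa [nsmul_eq_mul, mul_div_cancel₀ _ hm0] at this
  obtain ⟨x₀, hgen₀, hx₀X', hx₀acl⟩ := exists_log_partner₂ hsurj hiso hσ₀ hX hX' hkerX hya ha₀
  set x : Fin 1 → F₂ := ![x₀] with hxdef
  have hgen : IsGenericPt (locusIdeal₂' (Submodule.span ℚ ({τ₁} : Set F₁))
      (Submodule.span ℚ ({τ₂} : Set F₂)) hiso a) (gammaPt x) := by
    rw [ha_single]; exact hgen₀
  -- Step 5: the isomorphism step
  set kk : IntermediateField (fieldOf (Submodule.span ℚ ({τ₁} : Set F₁))) F₁ :=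
    bfld (Submodule.span ℚ ({τ₁} : Set F₁)) c with hkk
  set kk' : IntermediateField (fieldOf (Submodule.span ℚ ({τ₂} : Set F₂))) F₂ :=
    bfld (Submodule.span ℚ ({τ₂} : Set F₂)) c' with hkk'
  set θ := hiso.fieldEquiv with hθ
  have hfX_R : ∀ y ∈ fieldOf X, y ∈ Rfld kk (gammaPt a) := fun y hy =>
    algebraMap_mem_Rfld kk (gammaPt a) ⟨y, (mem_adjoinField_allGens_iff _ c).2 hy⟩
  have hrootsL : ∀ (d : ℕ), 0 < d → exp (τ₁ / (d : F₁)) ∈ Lb a S b := by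
    intro d hd
    refine Literature.FieldTheory.Kummer.mem_baseField_of_mem_allRoots_one _ ⟨d, hd, ?_⟩
    rw [← exp_nsmul, nsmul_eq_mul, mul_div_cancel₀ _ (Nat.cast_ne_zero.2 hd.ne'), exp_tau_eq_one hker]
  have hurootsL : ∀ (l : Fin r) (d : ℕ), 0 < d → exp (u l / (d : F₁)) ∈ Lb a S b := by
    intro l d hd
    refine Literature.FieldTheory.Kummer.mem_baseField_of_mem_allRoots _ l ⟨d, hd, ?_⟩
    rw [← exp_nsmul, nsmul_eq_mul, mul_div_cancel₀ _ (Nat.cast_ne_zero.2 hd.ne')]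
  have hexpX_L : ∀ y ∈ X, exp y ∈ Lb a S b := by
    intro y hy
    rw [hXu] at hy
    obtain ⟨y₀, hy₀, y₁, hy₁, rfl⟩ := Submodule.mem_sup.1 hy
    rw [exp_add]
    refine mul_mem ?_ (exp_mem_of_mem_span hurootsL hy₁)
    have hy₀' : y₀ ∈ Submodule.span ℚ (range ![τ₁]) := by simpa using hy₀
    exact exp_mem_of_mem_span (w := ![τ₁]) (fun i d hd => by simpa using hrootsL d hd) hy₀'
  have hS_L : S ⊆ Lb a S b := fun y hy => Literature.FieldTheory.Kummer.mem_baseField_of_mem _ (Or.inl hy)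
  have hX_L : (X : Set F₁) ⊆ Lb a S b := by
    intro y hy
    have hy' : y ∈ Submodule.span ℚ ({τ₁} ∪ range c) := by
      rw [Submodule.span_union]; exact hy
    exact mem_subfield_of_mem_span (fun z hz => hS_L (Or.inl hz)) hy'
  have hgensX_L : gens X ⊆ Lb a S b := by
    rintro y (hy | ⟨v, hv, rfl⟩)
    · exact hX_L hy
    · exact hexpX_L v hv
  have hfX_L : ∀ y ∈ fieldOf X, y ∈ Lb a S b := fun y hy =>
    fieldOf_subset_of_gens_subset hgensX_L hy
  have hLR : Lb a S b ≤ Rfld kk (gammaPt a) := by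
    refine Subfield.closure_le.2 ?_
    rintro y ((h1 | hS') | hbr)
    · obtain ⟨v, hv, rfl⟩ := allRoots_one_subset hker hτ hτX h1
      exact hfX_R _ (exp_mem_fieldOf hv)
    · rcases hS' with hS'' | ⟨j, rfl⟩
      · rcases hS'' with (hτ' | ⟨i, rfl⟩) | ⟨j, rfl⟩
        · rw [mem_singleton_iff.1 hτ']
          exact hfX_R _ (mem_fieldOf_of_mem hτX)
        · exact hfX_R _ (mem_fieldOf_of_mem
            (Submodule.mem_sup_right (Submodule.subset_span ⟨i, rfl⟩)))
        · rw [← hea j]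
          exact natCast_mul_mem_Rfld kk (gammaPt a) m (Sum.inl j)
      · exact apply_mem_Rfld kk (gammaPt a) (Sum.inr j)
    · obtain ⟨l, hl⟩ := mem_iUnion.1 hbr
      obtain ⟨v, hv, rfl⟩ := allRoots_exp_subset hker hτ hτX
        (show u l ∈ X from by rw [hXu]; exact Submodule.mem_sup_right (Submodule.subset_span ⟨l, rfl⟩)) hl
      exact hfX_R _ (exp_mem_fieldOf hv)
  have hkkL : ∀ y : kk, algebraMap kk F₁ y ∈ Lb a S b := fun y =>
    hfX_L _ ((mem_adjoinField_allGens_iff _ c).1 y.2)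
  have heL : ∀ j, (m : F₁) * a j ∈ Lb a S b := fun j => by
    rw [hea j]; exact hS_L (Or.inr ⟨j, rfl⟩)
  have hXkk : ∀ v ∈ X, ∃ y : kk, algebraMap kk F₁ y = v := fun v hv =>
    ⟨⟨v, (mem_adjoinField_allGens_iff _ c).2 (mem_fieldOf_of_mem hv)⟩, rfl⟩
  have hexpXkk : ∀ v ∈ X, ∃ y : kk, algebraMap kk F₁ y = exp v := fun v hv =>
    ⟨⟨exp v, (mem_adjoinField_allGens_iff _ c).2 (exp_mem_fieldOf hv)⟩, rfl⟩
  have hθexp : ∀ y₀ y₁ : kk, algebraMap kk F₁ y₀ ∈ X →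
      algebraMap kk F₁ y₁ = exp (algebraMap kk F₁ y₀) →
      algebraMap kk' F₂ (θ y₁) = exp (algebraMap kk' F₂ (θ y₀)) := by
    rintro ⟨v₀, hv₀⟩ ⟨v₁, hv₁⟩ hy₀ hy₁
    change v₀ ∈ X at hy₀
    change v₁ = exp v₀ at hy₁
    subst hy₁
    exact (hiso.fieldEquiv_exp hσ₀ hy₀).2
  obtain ⟨D, Θ, hgensD, hΘkk, hΘe, hΘexp⟩ := exists_ringHom_isoCore₂ θ hgen X hLR hX_L
    (by rintro _ ⟨v, hv, rfl⟩; exact hexpX_L v hv) hkkL heL hXkk hexpXkk hθexp hKum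
  rw [hea'] at hgensD hΘexp
  -- Step 6: the ring homomorphism on `⟨ℚτ₁, c, d⟩`
  set e' : Fin 1 → F₂ := fun j => (m : F₂) * x j with he'
  have hY : (Submodule.span ℚ ({τ₁} : Set F₁)) ⊔ Submodule.span ℚ (range (Fin.append c e)) =
      X ⊔ Submodule.span ℚ (range e) := by
    rw [ZilberHomogeneity.range_append, Submodule.span_union, hXdef, sup_assoc]
  set E₂ : IntermediateField (fieldOf (Submodule.span ℚ ({τ₁} : Set F₁))) F₁ :=
    IntermediateField.adjoin (fieldOf (Submodule.span ℚ ({τ₁} : Set F₁))) (allGens (Fin.append c e)) with hE₂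
  have hE₂D : ∀ y ∈ E₂, y ∈ D := by
    intro y hy
    have hy' : y ∈ fieldOf (X ⊔ Submodule.span ℚ (range e)) := by
      rw [← hY]; exact (mem_adjoinField_allGens_iff _ (Fin.append c e)).1 hy
    exact fieldOf_subset_of_gens_subset hgensD hy'
  let Θ' : E₂ →+* F₂ :=
    { toFun := fun y => Θ ⟨y.1, hE₂D y.1 y.2⟩
      map_one' := Θ.map_one
      map_mul' := fun y y' => Θ.map_mul ⟨y.1, hE₂D y.1 y.2⟩ ⟨y'.1, hE₂D y'.1 y'.2⟩
      map_zero' := Θ.map_zero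
      map_add' := fun y y' => Θ.map_add ⟨y.1, hE₂D y.1 y.2⟩ ⟨y'.1, hE₂D y'.1 y'.2⟩ }
  have hΘ' : ∀ (y : F₁) (hy : y ∈ E₂), Θ' ⟨y, hy⟩ = Θ ⟨y, hE₂D y hy⟩ := fun _ _ => rfl
  have hΘ'kk : ∀ (y : F₁) (hy : y ∈ kk) (hy' : y ∈ E₂), Θ' ⟨y, hy'⟩ = (θ ⟨y, hy⟩ : F₂) := by
    intro y hy hy'
    rw [hΘ']
    exact hΘkk ⟨y, hy⟩ (hE₂D y hy')
  -- Step 7: the cross Γ-isomorphism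
  have hisoY : IsGammaIsoTw₂ σ₀ (Fin.append c e) (Fin.append c' e') := by
    refine isGammaIsoTw₂_of_ringHom Θ' (fun κ => ?_) (fun i => ?_) (fun y hy => ?_)
    · have hκ : (κ : F₁) ∈ kk := (bfld (Submodule.span ℚ ({τ₁} : Set F₁)) c).algebraMap_mem κ
      rw [hΘ'kk _ hκ]
      exact hiso.coe_fieldEquiv_algebraMap κ
    · induction i using Fin.addCases with
      | left i =>
        have hci : c i ∈ kk := mem_adjoinField_of_mem_adjoin
          (lvAlgebra_le_adjoin_allGens _ 0 c (lvGens_mem_lvAlgebra _ 0 c (Sum.inl i)))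
        simp only [Fin.append_left]
        rw [hΘ'kk _ hci]
        have := hiso.coe_fieldEquiv_lvGens 0 (Sum.inl i)
        simpa using this
      | right j =>
        simp only [Fin.append_right]
        rw [hΘ']
        have key : ∀ (h : e j ∈ D), Θ ⟨e j, h⟩ = (m : F₂) * x j := by
          intro h
          have h' : (m : F₁) * a j ∈ D := by rw [hea j]; exact h
          have hsub : (⟨e j, h⟩ : D) = ⟨(m : F₁) * a j, h'⟩ := Subtype.ext (hea j).symm
          rw [hsub]
          exact hΘe j h'
        exact key _
    · rw [hΘ', hΘ']
      rw [hY] at hy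
      exact hΘexp y hy _ _
  -- Step 8: the output `d' = m x₀`
  refine ⟨(m : F₂) * x₀, ?_, ?_, ?_⟩
  · rw [← nsmul_eq_mul, exp_nsmul]
    have := zpow_mem_acl hx₀acl (m : ℤ)
    rwa [zpow_natCast] at this
  · intro h
    apply hx₀X'
    have h1 : ((m : ℚ)⁻¹ : ℚ) • ((m : F₂) * x₀) ∈ X' := X'.smul_mem _ h
    have h2 : ((m : ℚ)⁻¹ : ℚ) • ((m : F₂) * x₀) = x₀ := by
      rw [← nsmul_eq_mul, ← Nat.cast_smul_eq_nsmul ℚ, smul_smul,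
        inv_mul_cancel₀ (Nat.cast_ne_zero.2 hm.ne'), one_smul]
    rwa [h2] at h1
  · have he'eq : Fin.append c' e' = Fin.append c' ![(m : F₂) * x₀] := by
      congr 1
      funext j
      rw [Fin.fin_one_eq_zero j]
      simp [he', hxdef]
    rw [← he'eq]
    exact hisoY

end LogStep₂

end ZilberSaturationLog

namespace GammaField

open Literature.ModelTheory.ExponentialFields.ExponentialRing ZilberHomogeneity ZilberSaturationMain

variable {F₁ : Type u} [Field F₁] [CharZero F₁] [Literature.ModelTheory.ExponentialFields.ExponentialRing F₁]
variable {F₂ : Type u} [Field F₂] [CharZero F₂] [Literature.ModelTheory.ExponentialFields.ExponentialRing F₂]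
variable {K₁ : Submodule ℚ F₁} {K₂ : Submodule ℚ F₂} {σ : fieldOf K₁ ≃+* fieldOf K₂} {N n : ℕ}

/-! ### Transport of spans and tuples, across two fields -/

/-- Transport of a linear combination of elements of `K₁ + ℚT`. [folklore] -/
theorem IsGammaIsoTw₂.transport_sum_smul_of_mem {m a : ℕ} {T : Fin m → F₁} {T' : Fin m → F₂}
    (H : IsGammaIsoTw₂ σ T T') {y : Fin a → F₁} (hy : ∀ i, y i ∈ K₁ ⊔ Submodule.span ℚ (range T))
    (q : Fin a → ℚ) : H.transport (∑ i, q i • y i) = ∑ i, q i • H.transport (y i) := by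
  classical
  induction (Finset.univ : Finset (Fin a)) using Finset.induction_on with
  | empty =>
    rw [Finset.sum_empty, Finset.sum_empty, H.transport_of_mem K₁.zero_mem]
    have : (⟨(0 : F₁), mem_fieldOf_of_mem K₁.zero_mem⟩ : fieldOf K₁) = 0 := Subtype.ext rfl
    rw [this, map_zero]; rfl
  | insert i s hi ih =>
    rw [Finset.sum_insert hi, Finset.sum_insert hi, H.transport_add (Submodule.smul_mem _ _ (hy i))
      (Submodule.sum_mem _ fun j _ => Submodule.smul_mem _ _ (hy j)), H.transport_smul _ (hy i), ih]

/-- Monotonicity of transport images of spans. [folklore] -/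
theorem IsGammaIsoTw₂.sup_span_transport_le {m a b : ℕ} {T : Fin m → F₁} {T' : Fin m → F₂}
    (H : IsGammaIsoTw₂ σ T T') (hσ : IsEBaseIso₂ K₁ K₂ σ) {y : Fin a → F₁} {y' : Fin b → F₁}
    (hy' : ∀ i, y' i ∈ K₁ ⊔ Submodule.span ℚ (range T))
    (hle : K₁ ⊔ Submodule.span ℚ (range y) ≤ K₁ ⊔ Submodule.span ℚ (range y')) :
    K₂ ⊔ Submodule.span ℚ (range fun i => H.transport (y i)) ≤
      K₂ ⊔ Submodule.span ℚ (range fun i => H.transport (y' i)) := by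
  refine sup_le le_sup_left (Submodule.span_le.2 ?_)
  rintro _ ⟨i, rfl⟩
  have hyi : y i ∈ K₁ ⊔ Submodule.span ℚ (range y') :=
    hle (Submodule.mem_sup_right (Submodule.subset_span ⟨i, rfl⟩))
  obtain ⟨κ, hκ, w, hw, hsum⟩ := Submodule.mem_sup.1 hyi
  obtain ⟨q, rfl⟩ := (Submodule.mem_span_range_iff_exists_fun ℚ).1 hw
  show H.transport (y i) ∈ _
  rw [← hsum, H.transport_add (Submodule.mem_sup_left hκ)
    (Submodule.sum_mem _ fun j _ => Submodule.smul_mem _ _ (hy' j)), H.transport_of_mem hκ,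
    H.transport_sum_smul_of_mem hy' q]
  exact add_mem (Submodule.mem_sup_left (hσ.map_mem hκ)) (Submodule.mem_sup_right
    (Submodule.sum_mem _ fun j _ => Submodule.smul_mem _ _ (Submodule.subset_span ⟨j, rfl⟩)))

/-- The transport image of `K₁ + ℚy` only depends on the subspace `K₁ + ℚy`. [folklore] -/
theorem IsGammaIsoTw₂.sup_span_transport_comp_eq {m a b : ℕ} {T : Fin m → F₁} {T' : Fin m → F₂}
    (H : IsGammaIsoTw₂ σ T T') (hσ : IsEBaseIso₂ K₁ K₂ σ) {y : Fin a → F₁} {y' : Fin b → F₁}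
    (hy : ∀ i, y i ∈ K₁ ⊔ Submodule.span ℚ (range T)) (hy' : ∀ i, y' i ∈ K₁ ⊔ Submodule.span ℚ (range T))
    (heq : K₁ ⊔ Submodule.span ℚ (range y) = K₁ ⊔ Submodule.span ℚ (range y')) :
    K₂ ⊔ Submodule.span ℚ (range fun i => H.transport (y i)) =
      K₂ ⊔ Submodule.span ℚ (range fun i => H.transport (y' i)) :=
  le_antisymm (H.sup_span_transport_le hσ hy' heq.le) (H.sup_span_transport_le hσ hy heq.ge)

/-- **Cross Γ-isomorphisms agreeing on generators have the same transport.** [folklore] -/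
theorem IsGammaIsoTw₂.transport_eq_transport {m : ℕ} {x : Fin n → F₁} {x' : Fin n → F₂}
    {y : Fin m → F₁} {y' : Fin m → F₂} (h₁ : IsGammaIsoTw₂ σ x x') (h₂ : IsGammaIsoTw₂ σ y y')
    (hxy : ∀ i, x i ∈ K₁ ⊔ Submodule.span ℚ (range y)) (heq : ∀ i, h₂.transport (x i) = x' i)
    {z : F₁} (hz : z ∈ K₁ ⊔ Submodule.span ℚ (range x)) : h₁.transport z = h₂.transport z := by
  classical
  obtain ⟨κ, hκ, w, hw, rfl⟩ := Submodule.mem_sup.1 hz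
  obtain ⟨q, rfl⟩ := (Submodule.mem_span_range_iff_exists_fun ℚ).1 hw
  rw [h₁.transport_add_sum_smul hκ q]
  have hsum : (∑ i, q i • x i) ∈ K₁ ⊔ Submodule.span ℚ (range y) :=
    Submodule.sum_mem _ fun i _ => Submodule.smul_mem _ _ (hxy i)
  rw [h₂.transport_add (Submodule.mem_sup_left hκ) hsum, h₂.transport_of_mem hκ]
  congr 1
  induction (Finset.univ : Finset (Fin n)) using Finset.induction_on with
  | empty =>
    rw [Finset.sum_empty, Finset.sum_empty, h₂.transport_of_mem K₁.zero_mem]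
    have : (⟨(0 : F₁), mem_fieldOf_of_mem K₁.zero_mem⟩ : fieldOf K₁) = 0 := Subtype.ext rfl
    rw [this, map_zero]; rfl
  | insert i s hi ih =>
    rw [Finset.sum_insert hi, Finset.sum_insert hi,
      h₂.transport_add (Submodule.smul_mem _ _ (hxy i))
        (Submodule.sum_mem _ fun j _ => Submodule.smul_mem _ _ (hxy j)),
      h₂.transport_smul _ (hxy i), heq i, ih]

/-- **Relative linear independence is transported**: if `u` is linearly independent over
`K₁ + ℚc` (all inside `K₁ + ℚT`), then `θ(u)` is linearly independent over `K₂ + ℚθ(c)` (`θ` is an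
injective `σ`-semilinear map on `K₁ + ℚT` mapping `K₁ + ℚc` onto `K₂ + ℚθ(c)`). [folklore] -/
theorem IsGammaIsoTw₂.linIndepOver_transport {m a : ℕ} {T : Fin m → F₁} {T' : Fin m → F₂}
    (H : IsGammaIsoTw₂ σ T T') (hσ : IsEBaseIso₂ K₁ K₂ σ) {c : Fin N → F₁} {u : Fin a → F₁}
    (hc : ∀ i, c i ∈ K₁ ⊔ Submodule.span ℚ (range T)) (hu : ∀ j, u j ∈ K₁ ⊔ Submodule.span ℚ (range T))
    (hind : LinIndepOver (K₁ ⊔ Submodule.span ℚ (range c)) u) :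
    LinIndepOver (K₂ ⊔ Submodule.span ℚ (range fun i => H.transport (c i))) fun j => H.transport (u j) := by
  classical
  intro q hq
  rw [← H.transport_sum_smul_of_mem hu q] at hq
  obtain ⟨κ', hκ', w, hw, hsum⟩ := Submodule.mem_sup.1 hq
  obtain ⟨p, rfl⟩ := (Submodule.mem_span_range_iff_exists_fun ℚ).1 hw
  have hκ : (σ.symm ⟨κ', mem_fieldOf_of_mem hκ'⟩ : F₁) ∈ K₁ := hσ.symm_map_mem hκ'
  have hz₀ : (σ.symm ⟨κ', mem_fieldOf_of_mem hκ'⟩ : F₁) + ∑ i, p i • c i ∈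
      K₁ ⊔ Submodule.span ℚ (range c) :=
    add_mem (Submodule.mem_sup_left hκ) (Submodule.mem_sup_right
      (Submodule.sum_mem _ fun i _ => Submodule.smul_mem _ _ (Submodule.subset_span ⟨i, rfl⟩)))
  have hz₀T : (σ.symm ⟨κ', mem_fieldOf_of_mem hκ'⟩ : F₁) + ∑ i, p i • c i ∈
      K₁ ⊔ Submodule.span ℚ (range T) :=
    add_mem (Submodule.mem_sup_left hκ) (Submodule.sum_mem _ fun i _ => Submodule.smul_mem _ _ (hc i))
  have hquT : ∑ j, q j • u j ∈ K₁ ⊔ Submodule.span ℚ (range T) :=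
    Submodule.sum_mem _ fun j _ => Submodule.smul_mem _ _ (hu j)
  have hθz₀ : H.transport ((σ.symm ⟨κ', mem_fieldOf_of_mem hκ'⟩ : F₁) + ∑ i, p i • c i) =
      κ' + ∑ i, p i • H.transport (c i) := by
    rw [H.transport_add (Submodule.mem_sup_left hκ)
        (Submodule.sum_mem _ fun i _ => Submodule.smul_mem _ _ (hc i)),
      H.transport_of_mem hκ, H.transport_sum_smul_of_mem hc p]
    congr 1
    have : (⟨(σ.symm ⟨κ', mem_fieldOf_of_mem hκ'⟩ : F₁), mem_fieldOf_of_mem hκ⟩ : fieldOf K₁) =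
        σ.symm ⟨κ', mem_fieldOf_of_mem hκ'⟩ := Subtype.ext rfl
    rw [this, RingEquiv.apply_symm_apply]
  have heq : ∑ j, q j • u j = (σ.symm ⟨κ', mem_fieldOf_of_mem hκ'⟩ : F₁) + ∑ i, p i • c i := by
    rw [← H.transport_symm_transport hσ hquT, ← H.transport_symm_transport hσ hz₀T, hθz₀, hsum]
  exact hind q (heq ▸ hz₀)

/-- Pulling the core output back along a Case-1 step, across two fields. [folklore] -/
theorem corestep_of_case1₂ (hσ : IsEBaseIso₂ K₁ K₂ σ) {c : Fin N → F₁} {c' : Fin N → F₂}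
    {u : Fin n → F₁} {x : F₁} {x' : F₂} {n₁ : ℕ} {u₁ : Fin n₁ → F₁}
    (hu₁B : ∀ j, u₁ j ∈ (K₁ ⊔ Submodule.span ℚ (range c)) ⊔ Submodule.span ℚ (range u))
    (huB₁ : ∀ j, u j ∈ (K₁ ⊔ Submodule.span ℚ (range (Fin.append c ![x]))) ⊔ Submodule.span ℚ (range u₁))
    (hxB : x ∈ (K₁ ⊔ Submodule.span ℚ (range c)) ⊔ Submodule.span ℚ (range u))
    {m : ℕ} {T : Fin m → F₁} {T' : Fin m → F₂} (H : IsGammaIsoTw₂ σ T T')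
    (hcT : ∀ i, Fin.append c ![x] i ∈ K₁ ⊔ Submodule.span ℚ (range T))
    (huT : ∀ j, u₁ j ∈ K₁ ⊔ Submodule.span ℚ (range T))
    (hTc : ∀ i, H.transport (Fin.append c ![x] i) = Fin.append c' ![x'] i)
    (hstrong : IsStrong (K₂ ⊔ Submodule.span ℚ (range fun j => H.transport (Fin.append (Fin.append c ![x]) u₁ j)))) :
    ∃ (m : ℕ) (T : Fin m → F₁) (T' : Fin m → F₂) (H : IsGammaIsoTw₂ σ T T'),
      (∀ i, c i ∈ K₁ ⊔ Submodule.span ℚ (range T)) ∧ (∀ j, u j ∈ K₁ ⊔ Submodule.span ℚ (range T)) ∧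
      (∀ i, H.transport (c i) = c' i) ∧
      IsStrong (K₂ ⊔ Submodule.span ℚ (range fun j => H.transport (Fin.append c u j))) := by
  have hcT' : ∀ i, c i ∈ K₁ ⊔ Submodule.span ℚ (range T) := fun i => by
    simpa only [Fin.append_left] using hcT (Fin.castAdd 1 i)
  have hxT : x ∈ K₁ ⊔ Submodule.span ℚ (range T) := by
    simpa only [Fin.append_right, Matrix.cons_val_fin_one] using hcT (Fin.natAdd N 0)
  have hA₁T : (K₁ ⊔ Submodule.span ℚ (range (Fin.append c ![x]))) ⊔ Submodule.span ℚ (range u₁) ≤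
      K₁ ⊔ Submodule.span ℚ (range T) := by
    refine sup_le (sup_le le_sup_left (Submodule.span_le.2 ?_)) (Submodule.span_le.2 ?_)
    · rintro _ ⟨i, rfl⟩; exact hcT i
    · rintro _ ⟨j, rfl⟩; exact huT j
  have huT' : ∀ j, u j ∈ K₁ ⊔ Submodule.span ℚ (range T) := fun j => hA₁T (huB₁ j)
  refine ⟨m, T, T', H, hcT', huT', fun i => ?_, ?_⟩
  · have := hTc (Fin.castAdd 1 i)
    simpa only [Fin.append_left] using this
  · have heq : K₁ ⊔ Submodule.span ℚ (range (Fin.append c u)) =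
        K₁ ⊔ Submodule.span ℚ (range (Fin.append (Fin.append c ![x]) u₁)) := by
      simp only [ZilberHomogeneity.range_append, ZilberHomogeneity.range_single, Submodule.span_union, ← sup_assoc]
      refine le_antisymm (sup_le (le_sup_left.trans le_sup_left) (Submodule.span_le.2 ?_))
        (sup_le (sup_le le_sup_left ((Submodule.span_singleton_le_iff_mem _ _).2 hxB)) (Submodule.span_le.2 ?_))
      · rintro _ ⟨j, rfl⟩
        have := huB₁ j
        rwa [sup_span_range_append_single] at this
      · rintro _ ⟨j, rfl⟩; exact hu₁B j
    have hy1 : ∀ j, Fin.append c u j ∈ K₁ ⊔ Submodule.span ℚ (range T) := by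
      intro j
      refine Fin.addCases (fun i => ?_) (fun i => ?_) j
      · simpa only [Fin.append_left] using hcT' i
      · simpa only [Fin.append_right] using huT' i
    have hy2 : ∀ j, Fin.append (Fin.append c ![x]) u₁ j ∈ K₁ ⊔ Submodule.span ℚ (range T) := by
      intro j
      refine Fin.addCases (fun i => ?_) (fun i => ?_) j
      · simpa only [Fin.append_left] using hcT i
      · simpa only [Fin.append_right] using huT i
    rw [H.sup_span_transport_comp_eq hσ hy1 hy2 heq]
    exact hstrong

end GammaField

namespace ZilberSaturationLog

open GammaField Literature.ModelTheory.ExponentialFields.ExponentialRing ZilberHomogeneity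
  ZilberSaturationMain Literature.FieldTheory.Kummer

variable {F₁ : Type u} [Field F₁] [CharZero F₁] [Literature.ModelTheory.ExponentialFields.ExponentialRing F₁]
variable {F₂ : Type u} [Field F₂] [CharZero F₂] [Literature.ModelTheory.ExponentialFields.ExponentialRing F₂]
variable {N n : ℕ}

set_option maxHeartbeats 400000 in
/-- **Case 1 of the induction over `ℚτ`, across two fields.** If some `x ∈ B ∖ A`
(`A = ℚτ₁ + ℚc`, `B = A + ℚu`, in `F₁`) is algebraic over `Γ(A)` or has `exp x` algebraic over
`Γ(A)`, the cross Γ-isomorphism `c ↦ c'` over `σ₀` extends by `x` (the cross algebraic step, resp.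
the cross logarithmic step), the new bases are strong and `B` has a basis over `A + ℚx` of smaller
length with `δ = 0`. [cite: BaysKirby2018ANT, Lemma 8.3 (proof), Lemma 4.8, §4.4, Def. 5.14] -/
theorem exists_case1_reduct₂ [IsAlgClosed F₂] (hsurj : IsSurjectiveOntoUnits F₂)
    {τ₁ : F₁} (hker : expKernel F₁ = AddSubgroup.zmultiples τ₁) (hτ : τ₁ ≠ 0) {τ₂ : F₂}
    (hKfact : BaysKirby2018_divisionSequences_determined.{u})
    {σ₀ : fieldOf (Submodule.span ℚ ({τ₁} : Set F₁)) ≃+* fieldOf (Submodule.span ℚ ({τ₂} : Set F₂))}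
    (hσ₀ : IsEBaseIso₂ (Submodule.span ℚ ({τ₁} : Set F₁)) (Submodule.span ℚ ({τ₂} : Set F₂)) σ₀)
    {c : Fin N → F₁} {c' : Fin N → F₂} (hiso : IsGammaIsoTw₂ σ₀ c c')
    (hs : IsStrong (Submodule.span ℚ {τ₁} ⊔ Submodule.span ℚ (range c)))
    (hs' : IsStrong (Submodule.span ℚ {τ₂} ⊔ Submodule.span ℚ (range c'))) {u : Fin n → F₁}
    (hu : LinIndepOver (Submodule.span ℚ {τ₁} ⊔ Submodule.span ℚ (range c)) u)
    (htd : td (Submodule.span ℚ {τ₁} ⊔ Submodule.span ℚ (range c)) (Submodule.span ℚ (range u)) = n)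
    {x : F₁}
    (hxB : x ∈ (Submodule.span ℚ {τ₁} ⊔ Submodule.span ℚ (range c)) ⊔ Submodule.span ℚ (range u))
    (hxA : x ∉ Submodule.span ℚ {τ₁} ⊔ Submodule.span ℚ (range c))
    (hx : x ∈ acl (gens (Submodule.span ℚ {τ₁} ⊔ Submodule.span ℚ (range c))) ∨
      exp x ∈ acl (gens (Submodule.span ℚ {τ₁} ⊔ Submodule.span ℚ (range c)))) :
    ∃ (x' : F₂) (n₁ : ℕ) (u₁ : Fin n₁ → F₁), n₁ < n ∧
      IsGammaIsoTw₂ σ₀ (Fin.append c ![x]) (Fin.append c' ![x']) ∧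
      IsStrong (Submodule.span ℚ {τ₁} ⊔ Submodule.span ℚ (range (Fin.append c ![x]))) ∧
      IsStrong (Submodule.span ℚ {τ₂} ⊔ Submodule.span ℚ (range (Fin.append c' ![x']))) ∧
      LinIndepOver (Submodule.span ℚ {τ₁} ⊔ Submodule.span ℚ (range (Fin.append c ![x]))) u₁ ∧
      td (Submodule.span ℚ {τ₁} ⊔ Submodule.span ℚ (range (Fin.append c ![x])))
        (Submodule.span ℚ (range u₁)) = n₁ ∧
      (∀ j, u₁ j ∈ (Submodule.span ℚ {τ₁} ⊔ Submodule.span ℚ (range c)) ⊔ Submodule.span ℚ (range u)) ∧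
      (∀ j, u j ∈ (Submodule.span ℚ {τ₁} ⊔ Submodule.span ℚ (range (Fin.append c ![x]))) ⊔
        Submodule.span ℚ (range u₁)) := by
  classical
  -- the one-step extension and the strongness of the new bases
  have hstep : ∃ x' : F₂, IsGammaIsoTw₂ σ₀ (Fin.append c ![x]) (Fin.append c' ![x']) ∧
      IsStrong (Submodule.span ℚ {τ₂} ⊔ Submodule.span ℚ (range (Fin.append c' ![x']))) := by
    rcases hx with hx | hx
    · obtain ⟨x', hx'acl, hx'A, hγ⟩ := hiso.exists_append_single_of_mem_acl hσ₀ hs hs' hx hxA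
      refine ⟨x', hγ, ?_⟩
      rw [sup_span_range_append_single]
      exact isStrong_sup_span_singleton_of_mem_acl hs' hx'acl hx'A
    · obtain ⟨x', hx'acl, hx'A, hγ⟩ :=
        exists_append_single_of_exp_mem_acl₂ hsurj hker hτ hKfact hσ₀ hs hs' hiso hx hxA
      refine ⟨x', hγ, ?_⟩
      rw [sup_span_range_append_single]
      exact isStrong_sup_span_singleton_of_exp_mem_acl hs' hx'acl hx'A
  obtain ⟨x', hγ, hs₁'⟩ := hstep
  have hA₁ : (Submodule.span ℚ {τ₁}) ⊔ Submodule.span ℚ (range (Fin.append c ![x])) =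
      ((Submodule.span ℚ {τ₁}) ⊔ Submodule.span ℚ (range c)) ⊔ Submodule.span ℚ {x} := sup_span_range_append_single (Submodule.span ℚ {τ₁}) c x
  have htd1 : td ((Submodule.span ℚ {τ₁}) ⊔ Submodule.span ℚ (range c)) (Submodule.span ℚ {x}) ≤ 1 := by
    rcases hx with hx | hx
    · exact td_span_singleton_le_one_of_mem_acl hx
    · exact td_span_singleton_le_one_of_exp_mem_acl hx
  have hδx : predim ((Submodule.span ℚ {τ₁}) ⊔ Submodule.span ℚ (range c)) (Submodule.span ℚ {x}) = 0 :=
    (td_eq_one_and_predim_eq_zero_of_td_le_one hs hxA htd1).2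
  have hs₁ : IsStrong ((Submodule.span ℚ {τ₁}) ⊔ Submodule.span ℚ (range (Fin.append c ![x]))) := by
    rw [hA₁]
    exact hs.of_predim_eq_zero le_sup_left (isFG_sup_left.2 (isFG_span_of_finite _ (finite_singleton x)))
      (by rwa [predim_sup_left])
  -- a basis of `B` over `A + ℚx`
  obtain ⟨n₁, σ, hu₁, hu₁span⟩ := exists_linIndepOver_comp ((Submodule.span ℚ {τ₁}) ⊔ Submodule.span ℚ (range (Fin.append c ![x]))) u
  have hBeq : ((Submodule.span ℚ {τ₁}) ⊔ Submodule.span ℚ (range (Fin.append c ![x]))) ⊔ Submodule.span ℚ (range u) =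
      ((Submodule.span ℚ {τ₁}) ⊔ Submodule.span ℚ (range c)) ⊔ Submodule.span ℚ (range u) := by
    rw [hA₁]
    refine le_antisymm (sup_le (sup_le le_sup_left ((Submodule.span_singleton_le_iff_mem _ _).2 hxB)) le_sup_right) ?_
    exact sup_le (le_sup_left.trans le_sup_left) le_sup_right
  -- dimensions
  have hfgu : IsFG ((Submodule.span ℚ {τ₁}) ⊔ Submodule.span ℚ (range c)) (Submodule.span ℚ (range u)) :=
    isFG_span_of_finite _ (finite_range u)
  have hfgB : IsFG ((Submodule.span ℚ {τ₁}) ⊔ Submodule.span ℚ (range c))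
      (((Submodule.span ℚ {τ₁}) ⊔ Submodule.span ℚ (range (Fin.append c ![x]))) ⊔ Submodule.span ℚ (range u)) := by
    rw [hBeq]; exact isFG_sup_left.2 hfgu
  have hle₁ : (Submodule.span ℚ {τ₁}) ⊔ Submodule.span ℚ (range c) ≤ (Submodule.span ℚ {τ₁}) ⊔ Submodule.span ℚ (range (Fin.append c ![x])) := by
    rw [hA₁]; exact le_sup_left
  have hldim := ldim_add hle₁ (le_sup_left : (Submodule.span ℚ {τ₁}) ⊔ Submodule.span ℚ (range (Fin.append c ![x])) ≤
      ((Submodule.span ℚ {τ₁}) ⊔ Submodule.span ℚ (range (Fin.append c ![x]))) ⊔ Submodule.span ℚ (range u)) hfgB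
  have hl1 : ldim ((Submodule.span ℚ {τ₁}) ⊔ Submodule.span ℚ (range c)) ((Submodule.span ℚ {τ₁}) ⊔ Submodule.span ℚ (range (Fin.append c ![x]))) = 1 := by
    rw [hA₁, ldim_sup_left, ldim_span_singleton_of_not_mem hxA]
  have hl2 : ldim ((Submodule.span ℚ {τ₁}) ⊔ Submodule.span ℚ (range (Fin.append c ![x])))
      (((Submodule.span ℚ {τ₁}) ⊔ Submodule.span ℚ (range (Fin.append c ![x]))) ⊔ Submodule.span ℚ (range u)) = n₁ := by
    rw [← hu₁span, ldim_sup_left, ldim_span_eq_of_linIndepOver hu₁]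
  have hl3 : ldim ((Submodule.span ℚ {τ₁}) ⊔ Submodule.span ℚ (range c))
      (((Submodule.span ℚ {τ₁}) ⊔ Submodule.span ℚ (range (Fin.append c ![x]))) ⊔ Submodule.span ℚ (range u)) = n := by
    rw [hBeq, ldim_sup_left, ldim_span_eq_of_linIndepOver hu]
  rw [hl1, hl2, hl3] at hldim
  have hlt : n₁ < n := by omega
  have hδB : predim ((Submodule.span ℚ {τ₁}) ⊔ Submodule.span ℚ (range c))
      (((Submodule.span ℚ {τ₁}) ⊔ Submodule.span ℚ (range (Fin.append c ![x]))) ⊔ Submodule.span ℚ (range u)) = 0 := by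
    rw [hBeq, predim_sup_left, predim, htd, ldim_span_eq_of_linIndepOver hu]; simp
  have hpadd := predim_add hle₁ (le_sup_left : (Submodule.span ℚ {τ₁}) ⊔ Submodule.span ℚ (range (Fin.append c ![x])) ≤
      ((Submodule.span ℚ {τ₁}) ⊔ Submodule.span ℚ (range (Fin.append c ![x]))) ⊔ Submodule.span ℚ (range u)) hfgB
  have hδ1 : predim ((Submodule.span ℚ {τ₁}) ⊔ Submodule.span ℚ (range c)) ((Submodule.span ℚ {τ₁}) ⊔ Submodule.span ℚ (range (Fin.append c ![x]))) = 0 := by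
    rw [hA₁, predim_sup_left, hδx]
  rw [hδB, hδ1, zero_add] at hpadd
  have htd₁ : td ((Submodule.span ℚ {τ₁}) ⊔ Submodule.span ℚ (range (Fin.append c ![x]))) (Submodule.span ℚ (range (u ∘ σ))) = n₁ := by
    have h0 : predim ((Submodule.span ℚ {τ₁}) ⊔ Submodule.span ℚ (range (Fin.append c ![x]))) (Submodule.span ℚ (range (u ∘ σ))) = 0 := by
      rw [← predim_sup_left, hu₁span]
      exact hpadd.symm
    rw [predim, ldim_span_eq_of_linIndepOver hu₁] at h0
    have hne : td ((Submodule.span ℚ {τ₁}) ⊔ Submodule.span ℚ (range (Fin.append c ![x]))) (Submodule.span ℚ (range (u ∘ σ))) ≠ ⊤ :=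
      td_ne_top (isFG_span_of_finite _ (finite_range _))
    rw [← ENat.coe_toNat hne]
    congr 1
    omega
  refine ⟨x', n₁, u ∘ σ, hlt, hγ, hs₁, hs₁', hu₁, htd₁, fun j => ?_, fun j => ?_⟩
  · exact Submodule.mem_sup_right (Submodule.subset_span ⟨σ j, rfl⟩)
  · rw [hu₁span]
    exact Submodule.mem_sup_right (Submodule.subset_span ⟨j, rfl⟩)

/-- **The core of Lemma 8.3 over `ℚτ`, across two fields** (induction on the linear dimension of
`B/A`): for a cross Γ-isomorphism `c ↦ c'` over `σ₀` between strong subspaces and a basis `u` of a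
Γ-algebraic extension of `ℚτ₁ + ℚc` in `F₁`, there is a cross Γ-isomorphism `T ↦ T'` over `σ₀`
whose domain span contains `c` and `u`, transporting `c ↦ c'`, with the transport image of
`ℚτ₁ + ℚc + ℚu` strong in `F₂`. Case 1: `exists_case1_reduct₂` and recursion; Case 2 (the locus of
`u` is free): the cross main case `ZilberSaturationMain.exists_isGammaIsoTw₂_append_of_free`.
[cite: BaysKirby2018ANT, Lemma 8.3 (proof), Def. 5.14] -/
theorem corestep₂ [IsAlgClosed F₂] (hsurj : IsSurjectiveOntoUnits F₂) (hSEAC : IsStronglyExpAlgClosed F₂)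
    {τ₁ : F₁} (hker : expKernel F₁ = AddSubgroup.zmultiples τ₁) (hτ : τ₁ ≠ 0) {τ₂ : F₂}
    (hKfact : BaysKirby2018_divisionSequences_determined.{u})
    {σ₀ : fieldOf (Submodule.span ℚ ({τ₁} : Set F₁)) ≃+* fieldOf (Submodule.span ℚ ({τ₂} : Set F₂))}
    (hσ₀ : IsEBaseIso₂ (Submodule.span ℚ ({τ₁} : Set F₁)) (Submodule.span ℚ ({τ₂} : Set F₂)) σ₀) :
    ∀ (n : ℕ) {N : ℕ} {c : Fin N → F₁} {c' : Fin N → F₂} (_hiso : IsGammaIsoTw₂ σ₀ c c')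
      (_hs : IsStrong (Submodule.span ℚ {τ₁} ⊔ Submodule.span ℚ (range c)))
      (_hs' : IsStrong (Submodule.span ℚ {τ₂} ⊔ Submodule.span ℚ (range c'))) {u : Fin n → F₁}
      (_hu : LinIndepOver (Submodule.span ℚ {τ₁} ⊔ Submodule.span ℚ (range c)) u)
      (_htd : td (Submodule.span ℚ {τ₁} ⊔ Submodule.span ℚ (range c)) (Submodule.span ℚ (range u)) = n),
      ∃ (m : ℕ) (T : Fin m → F₁) (T' : Fin m → F₂) (H : IsGammaIsoTw₂ σ₀ T T'),
        (∀ i, c i ∈ Submodule.span ℚ {τ₁} ⊔ Submodule.span ℚ (range T)) ∧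
        (∀ j, u j ∈ Submodule.span ℚ {τ₁} ⊔ Submodule.span ℚ (range T)) ∧
        (∀ i, H.transport (c i) = c' i) ∧
        IsStrong (Submodule.span ℚ {τ₂} ⊔ Submodule.span ℚ (range fun j => H.transport (Fin.append c u j))) := by
  intro n
  induction n using Nat.strong_induction_on with
  | _ n ih =>
    intro N c c' hiso hs hs' u hu htd
    classical
    by_cases h1 : ∃ x ∈ ((Submodule.span ℚ {τ₁}) ⊔ Submodule.span ℚ (range c)) ⊔ Submodule.span ℚ (range u),
        x ∉ (Submodule.span ℚ {τ₁}) ⊔ Submodule.span ℚ (range c) ∧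
        (x ∈ acl (gens ((Submodule.span ℚ {τ₁}) ⊔ Submodule.span ℚ (range c))) ∨ exp x ∈ acl (gens ((Submodule.span ℚ {τ₁}) ⊔ Submodule.span ℚ (range c))))
    · -- Case 1
      obtain ⟨x, hxB, hxA, hx⟩ := h1
      obtain ⟨x', n₁, u₁, hlt, hγ, hs₁, hs₁', hu₁, htd₁, hu₁B, huB₁⟩ :=
        exists_case1_reduct₂ hsurj hker hτ hKfact hσ₀ hiso hs hs' hu htd hxB hxA hx
      obtain ⟨m, T, T', H, hcT, huT, hTc, hstr⟩ := ih n₁ hlt hγ hs₁ hs₁' hu₁ htd₁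
      exact corestep_of_case1₂ hσ₀ hu₁B huB₁ hxB H hcT huT hTc hstr
    · -- Case 2: the locus of `u` is free
      push Not at h1
      have hfree : ∀ m : Fin n → ℤ, m ≠ 0 →
          ∑ j, (m j : ℚ) • u j ∉ acl (gens ((Submodule.span ℚ {τ₁}) ⊔ Submodule.span ℚ (range c))) ∧
          exp (∑ j, (m j : ℚ) • u j) ∉ acl (gens ((Submodule.span ℚ {τ₁}) ⊔ Submodule.span ℚ (range c))) := by
        intro m hm
        have hmem : ∑ j, (m j : ℚ) • u j ∈ ((Submodule.span ℚ {τ₁}) ⊔ Submodule.span ℚ (range c)) ⊔ Submodule.span ℚ (range u) :=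
          Submodule.mem_sup_right (Submodule.sum_mem _ fun j _ =>
            Submodule.smul_mem _ _ (Submodule.subset_span ⟨j, rfl⟩))
        have hnot := hu.sum_intCast_smul_notMem hm
        exact ⟨fun h => ((h1 _ hmem hnot).1 h).elim, fun h => ((h1 _ hmem hnot).2 h).elim⟩
      obtain ⟨g, hγ, hstrong'⟩ :=
        exists_isGammaIsoTw₂_append_of_free hSEAC hker hτ hKfact hσ₀ hs hs' hiso hu htd hfree
      have hcT : ∀ i, c i ∈ (Submodule.span ℚ {τ₁}) ⊔ Submodule.span ℚ (range (Fin.append c u)) := fun i =>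
        Submodule.mem_sup_right (Submodule.subset_span ⟨Fin.castAdd n i, by simp⟩)
      have huT : ∀ j, u j ∈ (Submodule.span ℚ {τ₁}) ⊔ Submodule.span ℚ (range (Fin.append c u)) := fun j =>
        Submodule.mem_sup_right (Submodule.subset_span ⟨Fin.natAdd N j, by simp⟩)
      refine ⟨N + n, Fin.append c u, Fin.append c' g, hγ, hcT, huT, fun i => ?_, ?_⟩
      · have := hγ.transport_apply (Fin.castAdd n i)
        simpa only [Fin.append_left] using this
      · have : (fun j => hγ.transport (Fin.append c u j)) = Fin.append c' g :=
          funext fun j => hγ.transport_apply j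
        rw [this]
        exact hstrong'

/-- **Bays–Kirby 2018, Lemma 8.3 (⟹) over `ℚτ`, across two fields** (cross-field form of
`BaysKirby2018_saturation_of_isStronglyExpAlgClosed`; Def. 5.14: `ℵ₀`-saturation for finitely
generated Γ-algebraic strong extensions, the extension being presented in ANOTHER exponential
field with standard kernel). Let `F₁` be an exponential field with `ker exp = τ₁ℤ` (`τ₁ ≠ 0`),
`F₂` algebraically closed with `exp` onto `F₂ˣ` and strongly exponentially-algebraically closed,
`σ₀ : ℚ^{ab}(τ₁) ≅ ℚ^{ab}(τ₂)` an isomorphism of base Γ-fields. If `ℚτ₁ + ℚc ◁ F₁`, `ℚτ₂ + ℚc' ◁ F₂`,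
`c ↦ c'` is a cross Γ-isomorphism over `σ₀`, and `δ(e/ℚτ₁ + ℚc) = 0`, then — granted the Kummer
fact — there is `e'` in `F₂` with `(c, e) ↦ (c', e')` a cross Γ-isomorphism over `σ₀`,
`ℚτ₂ + ℚc' + ℚe' ◁ F₂` and `δ(e'/ℚτ₂ + ℚc') = 0`. [cite: BaysKirby2018ANT, Lemma 8.3, Def. 5.14, Thm 9.1] -/
theorem isGammaIsoTw₂_saturation_tau [IsAlgClosed F₂] (hsurj : IsSurjectiveOntoUnits F₂)
    (hSEAC : IsStronglyExpAlgClosed F₂)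
    {τ₁ : F₁} (hker : expKernel F₁ = AddSubgroup.zmultiples τ₁) (hτ : τ₁ ≠ 0) {τ₂ : F₂}
    (hKfact : BaysKirby2018_divisionSequences_determined.{u})
    {σ₀ : fieldOf (Submodule.span ℚ ({τ₁} : Set F₁)) ≃+* fieldOf (Submodule.span ℚ ({τ₂} : Set F₂))}
    (hσ₀ : IsEBaseIso₂ (Submodule.span ℚ ({τ₁} : Set F₁)) (Submodule.span ℚ ({τ₂} : Set F₂)) σ₀)
    {N k : ℕ} {c : Fin N → F₁} {c' : Fin N → F₂} {e : Fin k → F₁}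
    (hs : IsStrong (Submodule.span ℚ {τ₁} ⊔ Submodule.span ℚ (range c)))
    (hs' : IsStrong (Submodule.span ℚ {τ₂} ⊔ Submodule.span ℚ (range c')))
    (hiso : IsGammaIsoTw₂ σ₀ c c')
    (hδ : predim (Submodule.span ℚ {τ₁} ⊔ Submodule.span ℚ (range c)) (Submodule.span ℚ (range e)) = 0) :
    ∃ e' : Fin k → F₂, IsGammaIsoTw₂ σ₀ (Fin.append c e) (Fin.append c' e') ∧
      IsStrong (Submodule.span ℚ {τ₂} ⊔ Submodule.span ℚ (range (Fin.append c' e'))) ∧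
      predim (Submodule.span ℚ {τ₂} ⊔ Submodule.span ℚ (range c')) (Submodule.span ℚ (range e')) = 0 := by
  classical
  -- a basis of `B` over `A`
  obtain ⟨n, ρ, hu, hB⟩ := exists_linIndepOver_comp ((Submodule.span ℚ {τ₁}) ⊔ Submodule.span ℚ (range c)) e
  have hl' : ldim ((Submodule.span ℚ {τ₁}) ⊔ Submodule.span ℚ (range c)) (Submodule.span ℚ (range e)) = n := by
    rw [← ldim_sup_left, ← hB, ldim_sup_left, ldim_span_eq_of_linIndepOver hu]
  have htde : ((td ((Submodule.span ℚ {τ₁}) ⊔ Submodule.span ℚ (range c)) (Submodule.span ℚ (range e))).toNat : ℤ) = n := by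
    have h0 : predim ((Submodule.span ℚ {τ₁}) ⊔ Submodule.span ℚ (range c)) (Submodule.span ℚ (range e)) = 0 := hδ
    rw [predim, hl'] at h0
    omega
  have htd : td ((Submodule.span ℚ {τ₁}) ⊔ Submodule.span ℚ (range c)) (Submodule.span ℚ (range (e ∘ ρ))) = n := by
    have ht : td ((Submodule.span ℚ {τ₁}) ⊔ Submodule.span ℚ (range c)) (Submodule.span ℚ (range (e ∘ ρ))) =
        td ((Submodule.span ℚ {τ₁}) ⊔ Submodule.span ℚ (range c)) (Submodule.span ℚ (range e)) := by
      rw [← td_sup_left, hB, td_sup_left]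
    rw [ht]
    have hne : td ((Submodule.span ℚ {τ₁}) ⊔ Submodule.span ℚ (range c)) (Submodule.span ℚ (range e)) ≠ ⊤ :=
      td_ne_top (isFG_span_of_finite _ (finite_range e))
    rw [← ENat.coe_toNat hne]
    congr 1
    omega
  obtain ⟨m, T, T', H, hcT, huT, hTc, hstrong⟩ :=
    corestep₂ hsurj hSEAC hker hτ hKfact hσ₀ n hiso hs hs' hu htd
  -- memberships
  have hA_le : (Submodule.span ℚ {τ₁}) ⊔ Submodule.span ℚ (range c) ≤ (Submodule.span ℚ {τ₁}) ⊔ Submodule.span ℚ (range T) := by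
    refine sup_le le_sup_left (Submodule.span_le.2 ?_)
    rintro _ ⟨j, rfl⟩; exact hcT j
  have hle' : ((Submodule.span ℚ {τ₁}) ⊔ Submodule.span ℚ (range c)) ⊔ Submodule.span ℚ (range (e ∘ ρ)) ≤
      (Submodule.span ℚ {τ₁}) ⊔ Submodule.span ℚ (range T) := by
    refine sup_le hA_le (Submodule.span_le.2 ?_)
    rintro _ ⟨i, rfl⟩; exact huT i
  have heT : ∀ j, e j ∈ (Submodule.span ℚ {τ₁}) ⊔ Submodule.span ℚ (range T) := by
    intro j
    have : e j ∈ ((Submodule.span ℚ {τ₁}) ⊔ Submodule.span ℚ (range c)) ⊔ Submodule.span ℚ (range e) :=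
      Submodule.mem_sup_right (Submodule.subset_span ⟨j, rfl⟩)
    rw [← hB] at this
    exact hle' this
  have hy1 : ∀ j, Fin.append c e j ∈ (Submodule.span ℚ {τ₁}) ⊔ Submodule.span ℚ (range T) := by
    intro j
    refine Fin.addCases (fun i => ?_) (fun i => ?_) j
    · simpa only [Fin.append_left] using hcT i
    · simpa only [Fin.append_right] using heT i
  have hy2 : ∀ j, Fin.append c (e ∘ ρ) j ∈ (Submodule.span ℚ {τ₁}) ⊔ Submodule.span ℚ (range T) := by
    intro j
    refine Fin.addCases (fun i => ?_) (fun i => ?_) j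
    · simpa only [Fin.append_left] using hcT i
    · simpa only [Fin.append_right] using huT i
  have hceq : (fun i => H.transport (c i)) = c' := funext hTc
  -- the cross Γ-isomorphism
  have hγ : IsGammaIsoTw₂ σ₀ (Fin.append c e) (Fin.append c' fun j => H.transport (e j)) := by
    have := H.transfer hσ₀ (y := Fin.append c e) hy1
    rw [transport_append_eq] at this
    rwa [hceq] at this
  -- the image span
  have h1 : Fin.append c' (fun j => H.transport (e j)) = fun j => H.transport (Fin.append c e j) := by
    rw [transport_append_eq, hceq]
  have heq : (Submodule.span ℚ {τ₁}) ⊔ Submodule.span ℚ (range (Fin.append c e)) =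
      (Submodule.span ℚ {τ₁}) ⊔ Submodule.span ℚ (range (Fin.append c (e ∘ ρ))) := by
    rw [ZilberHomogeneity.range_append, ZilberHomogeneity.range_append, Submodule.span_union,
      Submodule.span_union, ← sup_assoc, ← sup_assoc, hB]
  have himg := H.sup_span_transport_comp_eq hσ₀ hy1 hy2 heq
  refine ⟨fun j => H.transport (e j), hγ, ?_, ?_⟩
  · rw [h1, himg]
    exact hstrong
  · -- `δ(e'/ℚτ₂ + ℚc') = td - ldim = n - n`
    have hind' : LinIndepOver ((Submodule.span ℚ {τ₂}) ⊔ Submodule.span ℚ (range c'))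
        fun j => H.transport ((e ∘ ρ) j) := by
      have := H.linIndepOver_transport hσ₀ hcT huT hu
      rwa [hceq] at this
    have hspan : ((Submodule.span ℚ {τ₂}) ⊔ Submodule.span ℚ (range c')) ⊔
          Submodule.span ℚ (range fun j => H.transport (e j)) =
        ((Submodule.span ℚ {τ₂}) ⊔ Submodule.span ℚ (range c')) ⊔
          Submodule.span ℚ (range fun j => H.transport ((e ∘ ρ) j)) := by
      have e1 : (Submodule.span ℚ {τ₂}) ⊔ Submodule.span ℚ (range fun j => H.transport (Fin.append c e j)) =
          ((Submodule.span ℚ {τ₂}) ⊔ Submodule.span ℚ (range c')) ⊔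
            Submodule.span ℚ (range fun j => H.transport (e j)) := by
        rw [transport_append_eq, hceq, ZilberHomogeneity.range_append, Submodule.span_union, ← sup_assoc]
      have e2 : (Submodule.span ℚ {τ₂}) ⊔ Submodule.span ℚ (range fun j => H.transport (Fin.append c (e ∘ ρ) j)) =
          ((Submodule.span ℚ {τ₂}) ⊔ Submodule.span ℚ (range c')) ⊔
            Submodule.span ℚ (range fun j => H.transport ((e ∘ ρ) j)) := by
        rw [transport_append_eq, hceq, ZilberHomogeneity.range_append, Submodule.span_union, ← sup_assoc]
      rw [← e1, ← e2, himg]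
    have hldim' : ldim ((Submodule.span ℚ {τ₂}) ⊔ Submodule.span ℚ (range c'))
        (Submodule.span ℚ (range fun j => H.transport (e j))) = n := by
      rw [← ldim_sup_left, hspan, ldim_sup_left, ldim_span_eq_of_linIndepOver hind']
    have htd' : td ((Submodule.span ℚ {τ₂}) ⊔ Submodule.span ℚ (range c'))
        (Submodule.span ℚ (range fun j => H.transport (e j))) =
        td ((Submodule.span ℚ {τ₁}) ⊔ Submodule.span ℚ (range c)) (Submodule.span ℚ (range e)) :=
      (hγ.td_sup_span_eq hσ₀).symm
    rw [predim, hldim', htd']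
    omega

/-- **Cross-field Lemma 8.3 over `ℚτ`, unconditionally** (the Kummer fact is the theorem
`Literature.FieldTheory.Kummer.BaysKirby2018_divisionSequences_determined_holds`).
[cite: BaysKirby2018ANT, Lemma 8.3, Def. 5.14, Thm 9.1] -/
theorem isGammaIsoTw₂_saturation_tau' [IsAlgClosed F₂] (hsurj : IsSurjectiveOntoUnits F₂)
    (hSEAC : IsStronglyExpAlgClosed F₂)
    {τ₁ : F₁} (hker : expKernel F₁ = AddSubgroup.zmultiples τ₁) (hτ : τ₁ ≠ 0) {τ₂ : F₂}
    {σ₀ : fieldOf (Submodule.span ℚ ({τ₁} : Set F₁)) ≃+* fieldOf (Submodule.span ℚ ({τ₂} : Set F₂))}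
    (hσ₀ : IsEBaseIso₂ (Submodule.span ℚ ({τ₁} : Set F₁)) (Submodule.span ℚ ({τ₂} : Set F₂)) σ₀)
    {N k : ℕ} {c : Fin N → F₁} {c' : Fin N → F₂} {e : Fin k → F₁}
    (hs : IsStrong (Submodule.span ℚ {τ₁} ⊔ Submodule.span ℚ (range c)))
    (hs' : IsStrong (Submodule.span ℚ {τ₂} ⊔ Submodule.span ℚ (range c')))
    (hiso : IsGammaIsoTw₂ σ₀ c c')
    (hδ : predim (Submodule.span ℚ {τ₁} ⊔ Submodule.span ℚ (range c)) (Submodule.span ℚ (range e)) = 0) :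
    ∃ e' : Fin k → F₂, IsGammaIsoTw₂ σ₀ (Fin.append c e) (Fin.append c' e') ∧
      IsStrong (Submodule.span ℚ {τ₂} ⊔ Submodule.span ℚ (range (Fin.append c' e'))) ∧
      predim (Submodule.span ℚ {τ₂} ⊔ Submodule.span ℚ (range c')) (Submodule.span ℚ (range e')) = 0 :=
  isGammaIsoTw₂_saturation_tau hsurj hSEAC hker hτ
    Literature.FieldTheory.Kummer.BaysKirby2018_divisionSequences_determined_holds hσ₀ hs hs' hiso hδ

end ZilberSaturationLog

end Literature.NumberTheory.Transcendental
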